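import Summits.AtomisticToContinuum.HydrodynamicLimit.Theorems.JParityClosureLocalSecondLawLedgerDefs

/-!
# P2 from an Enskog law for the strain-weighted marks: the conditional form of `stub_passivityCollisional`
(stmt-AtomisticToContinuum-13081, line `exact-entropy-ledger-three-passivities`, stub P2)

The registered stub P2 (`stub_passivityCollisional`: in the crux frame, `P(Regular ∧ T₂ < −η) ≤ δ`
eventually, `T₂ = T₂smooth + T₂coll` the collisional-pressure-EXCESS work of the ledger) is open as typed: its
collisional half `T₂coll` is the ordered-pair collision statistic of EvenStressEnskog's momentum-transfer marks
`Ξ_P^{kl} = a n̂ₖn̂ₗ` (crux stmt-AtomisticToContinuum-13079, OPEN) with the configuration-dependent weights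
`½ ∫ (φ/θ_r) b̄ ∂ₖu_{r,l} dx`.  This file isolates EXACTLY what P2 needs beyond classical calculus, as two named
statements in P2's own quantifier frame, and proves the reduction:

* `CollisionalWorkEnskogLaw` (W) — the EvenStressEnskog law for the strain-weighted marks: on the regular event,
  `T₂coll` is within `η` of its ENSKOG VALUE `T₂enskog = −½σ³∫₀^τ∫ (φ/θ_r) Y(ρ_rσ³) Σₖₗ B^{kl}_r ∂ₖu_{r,l}` in
  probability, `Y = (3/(2π)) f_ex′` the thermodynamic contact value and `B^{kl}_r` Enskog's pair functional of
  `Ξ_P^{kl}` at the coarse state (`enskogB`, closed one-point form `(4π/3)ρ_r²θ_r δ_{kl} + (8π/15)ρ_r Σ^dev_{r,kl}` of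
  EvenStressEnskog's `∫∫ b_r b_r Θ(Ξ_P^{kl}) dμ^N dμ^N`, by `∫((w−v)·ω)₊²ωₖωₗ dω = (2π/15)(|w−v|²δ_{kl}+2(w−v)ₖ(w−v)ₗ)`
  and the factorisation of the double empirical integral through `ρ_r, m_r, Σ_r`).  It follows from
  EvenStressEnskog verbatim by a finite-net / equicontinuity step in the weights (bounded and `r⁻⁴`-Lipschitz on
  the regular event) — crux-3-sized, OPEN.
* `WeightedKineticPassivity` (K) — the `(2/5)(Z−1)`-weighted copy of P1: `P(Regular ∧ T₁weighted < −η) ≤ δ` with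
  `T₁weighted = −(2/5)∫∫ (φ/θ_r)(Z(ρ_rσ³)−1) Σ^dev_r:∇u_r`; pre-shock it follows from `Σ^dev_r → 0` exactly as P1
  (the weight `(2/5)(Z−1) ∈ [0, (2/5)η₁K]` is bounded on the band) — OPEN with P1.
* `CollisionalWorkIntegrable` (I) — the honest-Bochner-integral content of `T₂smooth` and `T₁weighted` on the
  regular event (bounded measurable integrands: floors `ρ_r, θ_r ≥ c`, `Z − 1` continuous on the band by
  `EosBand.continuousOn_hsCompressibility`, `∂ₖu_r` the a.e. derivative of a Lipschitz field, time sections of the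
  flow measurable) — classical, provable now, deliberately kept separate (it is also an input of the ledger L).

THE REDUCTION (`passivityCollisional_of_enskog : W → K → I → Stubs.stub_passivityCollisional`'s statement): by the
thermodynamic cancellation `½σ³Y(ρσ³)B^{kl} = p_ex δ_{kl} + (2/5)(Z−1)Σ^dev_{kl}`
(`enskog_stress_closed_form`, i.e. `ρθ(Z−1) = ½σ³Y·(4π/3)ρ²θ` from `Z(η) = 1 + ηf_ex′(η)`), the Enskog value of
the collisional work cancels the excess-pressure work EXACTLY, pointwise in `(s, x)`:
`t2enskogI = t2smoothI + t1weightedI` (`t2enskogI_eq`), hence on the regular event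
`T₂ = (T₂coll − T₂enskog) + T₁weighted` (`T₂_eq_of_integrable`) and
`{Regular ∧ T₂ < −η} ⊆ {Regular ∧ η/2 < |T₂coll − T₂enskog|} ∪ {Regular ∧ T₁weighted < −η/2}` — a union bound.

References: H. van Beijeren, M. H. Ernst, Physica 68 (1973) 437 (Enskog collisional transfer); P. Résibois,
J. Stat. Phys. 19 (1978) 593; S. Chapman, T. G. Cowling, *The Mathematical Theory of Non-uniform Gases* (1970)
§16.4; H. Spohn, *Large Scale Dynamics of Interacting Particles* (1991), Part I §3.
-/

noncomputable section

namespace Summit.AtomisticToContinuum.HydrodynamicLimit.Theorems.LocalSecondLawLedger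

open scoped BigOperators Topology Classical MeasureTheory ENNReal InnerProductSpace
open Filter Set MeasureTheory
open Literature.MathematicalPhysics.KineticTheory
open Literature.Analysis.FluidPDE
open Summit.AtomisticToContinuum.HydrodynamicLimit.Theorems.LocalSecondLawNegative

variable {N : ℕ}

/-- `p_ex = ρθ(Z − 1)` (local copy of `pexC_eq_compressibility` of
`Theorems/JParityClosureLocalSecondLawCollisionalWorkRegularity.lean`, kept private to decouple the import). -/
private theorem pexC_eq_compressibility' (σ r : ℝ) (w : Phase N) (x₀ : T3) :
    pexC σ r w x₀ = rhoC r w x₀ * thetaC r w x₀ * (hsCompressibility (rhoC r w x₀ * σ ^ 3) - 1) := by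
  unfold pexC hsPressure; ring

/-- The Enskog stress in closed form, `½σ³Y B^{kl} = ρθ(Z−1)δ + (2/5)(Z−1)D` (local copy of
`enskog_stress_closed_form` of `Theorems/JParityClosureLocalSecondLawCollisionalWorkRegularity.lean`). -/
private theorem enskog_stress_closed_form' (σ ρ θ D δ : ℝ) :
    1 / 2 * σ ^ 3 * (3 / (2 * Real.pi) * deriv hsExcessFreeEnergy (ρ * σ ^ 3)) *
        (4 * Real.pi / 3 * ρ ^ 2 * θ * δ + 8 * Real.pi / 15 * ρ * D) =
      ρ * θ * (hsCompressibility (ρ * σ ^ 3) - 1) * δ +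
        2 / 5 * (hsCompressibility (ρ * σ ^ 3) - 1) * D := by
  unfold hsCompressibility
  field_simp; ring

/-! ## The Enskog value of the collisional work and the weighted kinetic work -/

/-- EvenStressEnskog's thermodynamic contact value `Y(η) = (3/(2π)) f_ex′(η)` (crux stmt-13079, verbatim; it is
Enskog's contact factor `χ`, `Z = 1 + (2π/3)ηχ`). -/
def enskogY (η : ℝ) : ℝ :=
  3 / (2 * Real.pi) * deriv hsExcessFreeEnergy η

/-- Enskog's pair functional `B^{kl}_r(x₀)` of the momentum-transfer mark `Ξ_P^{kl} = ((w−v)·n̂)₊ n̂ₖn̂ₗ` at the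
coarse state, in closed one-point form: `(4π/3)ρ_r²θ_r δ_{kl} + (8π/15)ρ_r Σ^dev_{r,kl}`.  This is
EvenStressEnskog's `∫∫ b_r(x₁,x₀)b_r(x₂,x₀) Θ(Ξ_P^{kl})(v₁,v₂) dμ^N dμ^N` evaluated by the second-moment identity
`∫_{S²}((w−v)·ω)₊² ωₖωₗ dω = (2π/15)(|w−v|²δ_{kl} + 2(w−v)ₖ(w−v)ₗ)` and
`∫∫ b b (v₁−v₂)ₖ(v₁−v₂)ₗ = 2ρ_r(Σ^dev_{r,kl} + ρ_rθ_rδ_{kl})`, `tr Σ^dev_r = 0`. -/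
def enskogB (r : ℝ) (w : Phase N) (x₀ : T3) (k l : Fin 3) : ℝ :=
  4 * Real.pi / 3 * rhoC r w x₀ ^ 2 * thetaC r w x₀ * (if k = l then 1 else 0) +
    8 * Real.pi / 15 * rhoC r w x₀ * devC r w x₀ k l

/-- The integrand of `T₂smooth` (verbatim): `(φ/θ_r) p_ex div u_r` at `(s, x)`. -/
def t2smoothI (σ r : ℝ) (φ : ℝ → T3 → ℝ) (Φ : Flow σ N) (z : Phase N) (s : ℝ) (x : T3) : ℝ :=
  φ s x / thetaC r (Φ.flow s z) x * pexC σ r (Φ.flow s z) x *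
    ∑ k : Fin 3, pD k (fun y => uC r (Φ.flow s z) y k) x

/-- The integrand of the Enskog value of the collisional work: `(φ/θ_r) · ½σ³Y(ρ_rσ³) · Σₖₗ B^{kl}_r ∂ₖu_{r,l}`. -/
def t2enskogI (σ r : ℝ) (φ : ℝ → T3 → ℝ) (Φ : Flow σ N) (z : Phase N) (s : ℝ) (x : T3) : ℝ :=
  φ s x / thetaC r (Φ.flow s z) x * (1 / 2 * σ ^ 3 * enskogY (rhoC r (Φ.flow s z) x * σ ^ 3)) *
    ∑ k : Fin 3, ∑ l : Fin 3, enskogB r (Φ.flow s z) x k l * pD k (fun y => uC r (Φ.flow s z) y l) x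

/-- The integrand of the weighted kinetic work: `(φ/θ_r) · (2/5)(Z(ρ_rσ³) − 1) · Σ^dev_r : ∇u_r`. -/
def t1weightedI (σ r : ℝ) (φ : ℝ → T3 → ℝ) (Φ : Flow σ N) (z : Phase N) (s : ℝ) (x : T3) : ℝ :=
  φ s x / thetaC r (Φ.flow s z) x * (2 / 5 * (hsCompressibility (rhoC r (Φ.flow s z) x * σ ^ 3) - 1)) *
    ∑ k : Fin 3, ∑ l : Fin 3, devC r (Φ.flow s z) x k l * pD k (fun y => uC r (Φ.flow s z) y l) x

/-- **The Enskog value of `T₂coll`**: `T₂enskog = −∫₀^τ∫ (φ/θ_r) ½σ³ Y(ρ_rσ³) Σₖₗ B^{kl}_r ∂ₖu_{r,l} dx ds` — what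
EvenStressEnskog predicts for the strain-weighted ordered-pair statistic `T₂coll = −collSum(½∫(φ/θ_r) b̄ a n̂ₖn̂ₗ∂ₖu_l)`
(the `½` of the ordered pairs is the `½` here). -/
def T₂enskog (σ r τ : ℝ) (φ : ℝ → T3 → ℝ) (Φ : Flow σ N) (z : Phase N) : ℝ :=
  -∫ s in Set.Icc (0 : ℝ) τ, ∫ x : T3, t2enskogI σ r φ Φ z s x

/-- **The `(Z−1)`-weighted kinetic-anisotropy work**: `T₁weighted = −(2/5)∫₀^τ∫ (φ/θ_r)(Z(ρ_rσ³)−1) Σ^dev_r:∇u_r`,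
the same statistic as `T₁` with the extra bounded non-negative weight `(2/5)(Z − 1)`. -/
def T₁weighted (σ r τ : ℝ) (φ : ℝ → T3 → ℝ) (Φ : Flow σ N) (z : Phase N) : ℝ :=
  -∫ s in Set.Icc (0 : ℝ) τ, ∫ x : T3, t1weightedI σ r φ Φ z s x

/-! ## The three named inputs -/

/-- **(W) Enskog law for the strain-weighted momentum-transfer marks** (EvenStressEnskog-type, P2's frame): given
the EOS band and a cap `η₁ < η₀`, for `σ < σ₀(profiles)`, any tied Euler solution and flows, horizon `τ`, smooth
`φ ≥ 0` vanishing before `τ`, floor `c > 0`: `P( Regular ∧ |T₂coll − T₂enskog| > η ) ≤ δ` for `r < r₀`, `N ≥ N₀(r)`.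
The marks are EvenStressEnskog's `Ξ_P^{kl}` at `(ε⁻¹sepVec xᵢ xⱼ, vin)` (same `impulse`, `nrm`), the weights
`½∫(φ/θ_r) b̄ᵢⱼ ∂ₖu_{r,l}` are configuration-dependent but bounded and `r⁻⁴`-Lipschitz on the regular event (finite-net
reduction to crux 3 with fixed continuous `χ`); `b̄ᵢⱼ = b_r(xᵢ,·) + O(ε_N/r)`.  OPEN (⟸ crux stmt-13079 + net); an open
named conjecture of this line (`@[conjecture]`: provable or refutable by name). -/
@[conjecture] def CollisionalWorkEnskogLaw : Prop :=
  ∀ (η₀ : ℝ) (F : ℝ → ℝ), EosBand η₀ F → ∀ η₁ : ℝ, 0 < η₁ → η₁ < η₀ →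
  ∀ (a₀ θ₀ : T3 → ℝ) (u₀ : T3 → V3), Continuous a₀ → Continuous θ₀ → Continuous u₀ →
    (∀ x, 0 < a₀ x) → (∀ x, 0 < θ₀ x) → ∃ σ₀ : ℝ, 0 < σ₀ ∧ ∀ σ : ℝ, 0 < σ → σ < σ₀ →
    ∀ (T : ℝ) (ρ θ : ℝ → T3 → ℝ) (u : ℝ → T3 → V3), IsHardSphereEulerSolution σ T ρ u θ →
    ∀ Φ : (N : ℕ) → Flow σ N,
    TendstoHydroFieldsAt (fun N => localGibbsLaw σ a₀ u₀ θ₀ N (Φ N)) Φ ρ u θ 0 → 0 < T →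
    ∀ τ : ℝ, 0 < τ → ∀ φ : ℝ → T3 → ℝ, Literature.Analysis.FunctionSpaces.Torus.IsSmoothSpaceTimeOn Set.univ φ →
    (∀ s x, 0 ≤ φ s x) → (∃ τ' : ℝ, τ' < τ ∧ ∀ s, τ' ≤ s → ∀ x, φ s x = 0) →
    ∀ c : ℝ, 0 < c →
    ∀ η δ : ℝ, 0 < η → 0 < δ → ∃ r₀ : ℝ, 0 < r₀ ∧ ∀ r : ℝ, 0 < r → r < r₀ → ∃ N₀ : ℕ, ∀ N : ℕ, N₀ ≤ N →
      localGibbsLaw σ a₀ u₀ θ₀ N (Φ N)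
          {z | Regular σ r τ c η₁ (Φ N) z ∧ η < |T₂coll σ r τ φ (Φ N) z - T₂enskog σ r τ φ (Φ N) z|}
        ≤ ENNReal.ofReal δ

/-- **(K) Weighted kinetic passivity** (P1-type, P2's frame): `P( Regular ∧ T₁weighted < −η ) ≤ δ` eventually — the
unresolved kinetic anisotropy `Σ^dev_r` does asymptotically no positive work on the resolved strain weighted by
`(φ/θ_r)(2/5)(Z(ρ_rσ³) − 1)`.  Pre-shock ⟸ `Σ^dev_r → 0` (cruxes 2 + 4, as P1); post-shock the compressivity bet
of P1.  OPEN with P1; an open named conjecture of this line (`@[conjecture]`). -/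
@[conjecture] def WeightedKineticPassivity : Prop :=
  ∀ (η₀ : ℝ) (F : ℝ → ℝ), EosBand η₀ F → ∀ η₁ : ℝ, 0 < η₁ → η₁ < η₀ →
  ∀ (a₀ θ₀ : T3 → ℝ) (u₀ : T3 → V3), Continuous a₀ → Continuous θ₀ → Continuous u₀ →
    (∀ x, 0 < a₀ x) → (∀ x, 0 < θ₀ x) → ∃ σ₀ : ℝ, 0 < σ₀ ∧ ∀ σ : ℝ, 0 < σ → σ < σ₀ →
    ∀ (T : ℝ) (ρ θ : ℝ → T3 → ℝ) (u : ℝ → T3 → V3), IsHardSphereEulerSolution σ T ρ u θ →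
    ∀ Φ : (N : ℕ) → Flow σ N,
    TendstoHydroFieldsAt (fun N => localGibbsLaw σ a₀ u₀ θ₀ N (Φ N)) Φ ρ u θ 0 → 0 < T →
    ∀ τ : ℝ, 0 < τ → ∀ φ : ℝ → T3 → ℝ, Literature.Analysis.FunctionSpaces.Torus.IsSmoothSpaceTimeOn Set.univ φ →
    (∀ s x, 0 ≤ φ s x) → (∃ τ' : ℝ, τ' < τ ∧ ∀ s, τ' ≤ s → ∀ x, φ s x = 0) →
    ∀ c : ℝ, 0 < c →
    ∀ η δ : ℝ, 0 < η → 0 < δ → ∃ r₀ : ℝ, 0 < r₀ ∧ ∀ r : ℝ, 0 < r → r < r₀ → ∃ N₀ : ℕ, ∀ N : ℕ, N₀ ≤ N →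
      localGibbsLaw σ a₀ u₀ θ₀ N (Φ N)
          {z | Regular σ r τ c η₁ (Φ N) z ∧ T₁weighted σ r τ φ (Φ N) z < -η}
        ≤ ENNReal.ofReal δ

/-- **(I) Integrability of the smooth collisional-work integrands on the regular event** (the junk-freeness of the
Bochner integrals `T₂smooth`, `T₁weighted`; deterministic, the ledger's frame): for every regular `z` the space
integrands are integrable on `𝕋³` at every `s ∈ [0, τ]` and their space integrals are integrable on `[0, τ]`.
Classical (bounded measurable integrands on a probability space), provable now; kept as a named statement
(`@[conjecture]`, to be discharged by name in `Theorems/JParityClosureLocalSecondLawCollisionalWorkIntegrable.lean`). -/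
@[conjecture] def CollisionalWorkIntegrable : Prop :=
  ∀ (η₀ : ℝ) (F : ℝ → ℝ), EosBand η₀ F →
  ∀ (η₁ c σ r τ : ℝ), η₁ < η₀ → 0 < c → 0 < σ → 0 < r → 0 < τ →
  ∀ φ : ℝ → T3 → ℝ, Literature.Analysis.FunctionSpaces.Torus.IsSmoothSpaceTimeOn Set.univ φ →
  ∀ (N : ℕ) (Φ : Flow σ N) (z : Phase N), Regular σ r τ c η₁ Φ z →
    (∀ s ∈ Set.Icc (0 : ℝ) τ,
        Integrable (t2smoothI σ r φ Φ z s) ∧ Integrable (t1weightedI σ r φ Φ z s)) ∧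
      IntegrableOn (fun s => ∫ x : T3, t2smoothI σ r φ Φ z s x) (Set.Icc 0 τ) ∧
      IntegrableOn (fun s => ∫ x : T3, t1weightedI σ r φ Φ z s x) (Set.Icc 0 τ)

/-! ## The pointwise cancellation and the reduction -/

/-- `T₂smooth` is the double integral of `t2smoothI` (definitional). -/
theorem T₂smooth_eq (σ r τ : ℝ) (φ : ℝ → T3 → ℝ) (Φ : Flow σ N) (z : Phase N) :
    T₂smooth σ r τ φ Φ z = ∫ s in Set.Icc (0 : ℝ) τ, ∫ x : T3, t2smoothI σ r φ Φ z s x := rfl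

/-- Contracting Enskog's pair functional with the strain: `Σₖₗ B^{kl}∂ₖu_l = (4π/3)ρ²θ div u + (8π/15)ρ Σ^dev:∇u`. -/
theorem sum_enskogB_mul (r : ℝ) (w : Phase N) (x₀ : T3) (G : Fin 3 → Fin 3 → ℝ) :
    ∑ k : Fin 3, ∑ l : Fin 3, enskogB r w x₀ k l * G k l =
      4 * Real.pi / 3 * rhoC r w x₀ ^ 2 * thetaC r w x₀ * ∑ k : Fin 3, G k k +
        8 * Real.pi / 15 * rhoC r w x₀ * ∑ k : Fin 3, ∑ l : Fin 3, devC r w x₀ k l * G k l := by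
  simp only [enskogB, add_mul, Finset.sum_add_distrib, mul_ite, mul_one, mul_zero, ite_mul, zero_mul,
    Finset.sum_ite_eq, Finset.mem_univ, if_true, Finset.mul_sum, mul_assoc]

/-- **The pointwise thermodynamic cancellation**: the Enskog collisional-work integrand is the excess-pressure
work integrand plus the weighted kinetic-work integrand, `t2enskogI = t2smoothI + t1weightedI` — i.e.
`½σ³Y B^{kl} = p_ex δ_{kl} + (2/5)(Z−1)Σ^dev_{kl}` contracted with `(φ/θ_r)∂ₖu_{r,l}` (`enskog_stress_closed_form`,
`pexC_eq_compressibility`).  Unconditional (pure algebra over `Z(η) = 1 + ηf_ex′(η)`). -/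
theorem t2enskogI_eq (σ r : ℝ) (φ : ℝ → T3 → ℝ) (Φ : Flow σ N) (z : Phase N) (s : ℝ) (x : T3) :
    t2enskogI σ r φ Φ z s x = t2smoothI σ r φ Φ z s x + t1weightedI σ r φ Φ z s x := by
  simp only [t2enskogI, t2smoothI, t1weightedI, sum_enskogB_mul, pexC_eq_compressibility', enskogY]
  have h := enskog_stress_closed_form' σ (rhoC r (Φ.flow s z) x) (thetaC r (Φ.flow s z) x)
    (∑ k : Fin 3, ∑ l : Fin 3, devC r (Φ.flow s z) x k l * pD k (fun y => uC r (Φ.flow s z) y l) x)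
    (∑ k : Fin 3, pD k (fun y => uC r (Φ.flow s z) y k) x)
  set W := φ s x / thetaC r (Φ.flow s z) x
  linear_combination W * h

/-- **`T₂ = (T₂coll − T₂enskog) + T₁weighted` on the regular event** (given the integrability package): the
Enskog value of the collisional work cancels the excess-pressure work exactly. -/
theorem T₂_eq_of_integrable {σ r τ : ℝ} {φ : ℝ → T3 → ℝ} {Φ : Flow σ N} {z : Phase N}
    (h1 : ∀ s ∈ Set.Icc (0 : ℝ) τ, Integrable (t2smoothI σ r φ Φ z s) ∧ Integrable (t1weightedI σ r φ Φ z s))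
    (h2 : IntegrableOn (fun s => ∫ x : T3, t2smoothI σ r φ Φ z s x) (Set.Icc 0 τ))
    (h3 : IntegrableOn (fun s => ∫ x : T3, t1weightedI σ r φ Φ z s x) (Set.Icc 0 τ)) :
    T₂ σ r τ φ Φ z = (T₂coll σ r τ φ Φ z - T₂enskog σ r τ φ Φ z) + T₁weighted σ r τ φ Φ z := by
  have hE : T₂enskog σ r τ φ Φ z = -(T₂smooth σ r τ φ Φ z - T₁weighted σ r τ φ Φ z) := by
    rw [T₂enskog, T₂smooth_eq, T₁weighted, sub_neg_eq_add]
    congr 1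
    have hinner : ∀ s ∈ Set.Icc (0 : ℝ) τ, ∫ x : T3, t2enskogI σ r φ Φ z s x =
        (∫ x : T3, t2smoothI σ r φ Φ z s x) + ∫ x : T3, t1weightedI σ r φ Φ z s x := by
      intro s hs
      rw [← integral_add (h1 s hs).1 (h1 s hs).2]
      exact integral_congr_ae (Filter.Eventually.of_forall fun x => t2enskogI_eq σ r φ Φ z s x)
    rw [setIntegral_congr_fun measurableSet_Icc hinner, integral_add h2 h3]
  rw [T₂_eq, hE]
  ring

/-- The event inclusion behind the union bound: on the regular event, `T₂ < −η` forces either the Enskog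
deviation `|T₂coll − T₂enskog| > η/2` or the weighted kinetic work `T₁weighted < −η/2`. -/
theorem setOf_T₂_lt_subset {σ r τ c η₁ η : ℝ} {φ : ℝ → T3 → ℝ} {Φ : Flow σ N}
    (hI : ∀ z : Phase N, Regular σ r τ c η₁ Φ z →
      (∀ s ∈ Set.Icc (0 : ℝ) τ, Integrable (t2smoothI σ r φ Φ z s) ∧ Integrable (t1weightedI σ r φ Φ z s)) ∧
        IntegrableOn (fun s => ∫ x : T3, t2smoothI σ r φ Φ z s x) (Set.Icc 0 τ) ∧
        IntegrableOn (fun s => ∫ x : T3, t1weightedI σ r φ Φ z s x) (Set.Icc 0 τ)) :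
    {z : Phase N | Regular σ r τ c η₁ Φ z ∧ T₂ σ r τ φ Φ z < -η} ⊆
      {z | Regular σ r τ c η₁ Φ z ∧ η / 2 < |T₂coll σ r τ φ Φ z - T₂enskog σ r τ φ Φ z|} ∪
        {z | Regular σ r τ c η₁ Φ z ∧ T₁weighted σ r τ φ Φ z < -(η / 2)} := by
  rintro z ⟨hR, hT⟩
  obtain ⟨h1, h2, h3⟩ := hI z hR
  rw [T₂_eq_of_integrable h1 h2 h3] at hT
  by_cases hK : T₁weighted σ r τ φ Φ z < -(η / 2)
  · exact Or.inr ⟨hR, hK⟩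
  · refine Or.inl ⟨hR, ?_⟩
    have hlt : T₂coll σ r τ φ Φ z - T₂enskog σ r τ φ Φ z < -(η / 2) := by linarith [not_lt.1 hK]
    calc η / 2 < -(T₂coll σ r τ φ Φ z - T₂enskog σ r τ φ Φ z) := by linarith
      _ ≤ |T₂coll σ r τ φ Φ z - T₂enskog σ r τ φ Φ z| := neg_le_abs _

/-- **P2 from (W) + (K) + (I)** — the conditional form of `stub_passivityCollisional` for the next wave: an
EvenStressEnskog law for the strain-weighted marks, the `(Z−1)`-weighted kinetic passivity and the integrability
package imply the registered stub's statement verbatim (thresholds: `σ₀ := min`, both inputs run at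
`(η/2, δ/2)`, `r₀ := min`, `N₀ := max`; then `setOf_T₂_lt_subset` and `measure_union_le`). -/
theorem passivityCollisional_of_enskog :
  CollisionalWorkEnskogLaw → WeightedKineticPassivity → CollisionalWorkIntegrable →
  ∀ (η₀ : ℝ) (F : ℝ → ℝ), EosBand η₀ F → ∀ η₁ : ℝ, 0 < η₁ → η₁ < η₀ →
  ∀ (a₀ θ₀ : T3 → ℝ) (u₀ : T3 → V3), Continuous a₀ → Continuous θ₀ → Continuous u₀ →
    (∀ x, 0 < a₀ x) → (∀ x, 0 < θ₀ x) → ∃ σ₀ : ℝ, 0 < σ₀ ∧ ∀ σ : ℝ, 0 < σ → σ < σ₀ →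
    ∀ (T : ℝ) (ρ θ : ℝ → T3 → ℝ) (u : ℝ → T3 → V3), IsHardSphereEulerSolution σ T ρ u θ →
    ∀ Φ : (N : ℕ) → Flow σ N,
    TendstoHydroFieldsAt (fun N => localGibbsLaw σ a₀ u₀ θ₀ N (Φ N)) Φ ρ u θ 0 → 0 < T →
    ∀ τ : ℝ, 0 < τ → ∀ φ : ℝ → T3 → ℝ, Literature.Analysis.FunctionSpaces.Torus.IsSmoothSpaceTimeOn Set.univ φ →
    (∀ s x, 0 ≤ φ s x) → (∃ τ' : ℝ, τ' < τ ∧ ∀ s, τ' ≤ s → ∀ x, φ s x = 0) →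
    ∀ c : ℝ, 0 < c →
    ∀ η δ : ℝ, 0 < η → 0 < δ → ∃ r₀ : ℝ, 0 < r₀ ∧ ∀ r : ℝ, 0 < r → r < r₀ → ∃ N₀ : ℕ, ∀ N : ℕ, N₀ ≤ N →
      localGibbsLaw σ a₀ u₀ θ₀ N (Φ N)
          {z | Regular σ r τ c η₁ (Φ N) z ∧ T₂ σ r τ φ (Φ N) z < -η}
        ≤ ENNReal.ofReal δ := by
  intro hW hK hI η₀ F hE η₁ hη₁ hη₁lt a₀ θ₀ u₀ ha hθ hu ha0 hθ0
  obtain ⟨σW, hσW, HW⟩ := hW η₀ F hE η₁ hη₁ hη₁lt a₀ θ₀ u₀ ha hθ hu ha0 hθ0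
  obtain ⟨σK, hσK, HK⟩ := hK η₀ F hE η₁ hη₁ hη₁lt a₀ θ₀ u₀ ha hθ hu ha0 hθ0
  refine ⟨min σW σK, lt_min hσW hσK, ?_⟩
  intro σ hσ hσlt T ρ θ u hEu Φ h0 hT τ hτ φ hφ hφ0 hsupp c hc η δ hη hδ
  have hη2 : 0 < η / 2 := by positivity
  have hδ2 : 0 < δ / 2 := by positivity
  obtain ⟨rW, hrW, HrW⟩ := HW σ hσ (lt_of_lt_of_le hσlt (min_le_left _ _)) T ρ θ u hEu Φ h0 hT τ hτ φ hφ
    hφ0 hsupp c hc (η / 2) (δ / 2) hη2 hδ2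
  obtain ⟨rK, hrK, HrK⟩ := HK σ hσ (lt_of_lt_of_le hσlt (min_le_right _ _)) T ρ θ u hEu Φ h0 hT τ hτ φ hφ
    hφ0 hsupp c hc (η / 2) (δ / 2) hη2 hδ2
  refine ⟨min rW rK, lt_min hrW hrK, fun r hr hrlt => ?_⟩
  obtain ⟨NW, HNW⟩ := HrW r hr (lt_of_lt_of_le hrlt (min_le_left _ _))
  obtain ⟨NK, HNK⟩ := HrK r hr (lt_of_lt_of_le hrlt (min_le_right _ _))
  refine ⟨max NW NK, fun N hN => ?_⟩
  have hW' := HNW N (le_trans (le_max_left _ _) hN)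
  have hK' := HNK N (le_trans (le_max_right _ _) hN)
  have hsub := setOf_T₂_lt_subset (η := η) (fun z hz =>
    hI η₀ F hE η₁ c σ r τ hη₁lt hc hσ hr hτ φ hφ N (Φ N) z hz)
  calc localGibbsLaw σ a₀ u₀ θ₀ N (Φ N) {z | Regular σ r τ c η₁ (Φ N) z ∧ T₂ σ r τ φ (Φ N) z < -η}
      ≤ localGibbsLaw σ a₀ u₀ θ₀ N (Φ N)
          ({z | Regular σ r τ c η₁ (Φ N) z ∧
              η / 2 < |T₂coll σ r τ φ (Φ N) z - T₂enskog σ r τ φ (Φ N) z|} ∪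
            {z | Regular σ r τ c η₁ (Φ N) z ∧ T₁weighted σ r τ φ (Φ N) z < -(η / 2)}) :=
        measure_mono hsub
    _ ≤ localGibbsLaw σ a₀ u₀ θ₀ N (Φ N)
          {z | Regular σ r τ c η₁ (Φ N) z ∧ η / 2 < |T₂coll σ r τ φ (Φ N) z - T₂enskog σ r τ φ (Φ N) z|} +
        localGibbsLaw σ a₀ u₀ θ₀ N (Φ N)
          {z | Regular σ r τ c η₁ (Φ N) z ∧ T₁weighted σ r τ φ (Φ N) z < -(η / 2)} :=
        measure_union_le _ _
    _ ≤ ENNReal.ofReal (δ / 2) + ENNReal.ofReal (δ / 2) := add_le_add hW' hK'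
    _ = ENNReal.ofReal δ := by
        rw [← ENNReal.ofReal_add hδ2.le hδ2.le]
        congr 1
        ring

end Summit.AtomisticToContinuum.HydrodynamicLimit.Theorems.LocalSecondLawLedger

end
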